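import Summits.HodgeConjecture.HodgeConjecture.Theorems.H413FinCoeffPureTensor
import Literature.NumberTheory.Automorphic.UnitaryGroupDualPairReindexPlaces
import Literature.NumberTheory.Automorphic.UnitaryGroupFinAdelicCenterLocal
import Literature.NumberTheory.GelbartRogawski1991.FiniteAdelicSplittingAssembly
import Mathlib.Analysis.Complex.Circle
import HarnessLib

/-!
# H413 ∕ S4′(ii) (FIN), step (F2) at a place-assembled Weil representation `Ω = ⊗'_v ω_v`

Crux H413, line `F0_P4AdmissibleOccursInH1`, stub S4b.  Sequel of `H413FinCoeffPureTensor.lean` (the abstract pure-tensor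
identity `finCoeff_isPureTensor`): here the operator is the restriction along the pair embedding `u ↦ 1 ⊗ u`
(`UnitaryGroup.finPairEmb … (1, u)`) of the place-assembled finite Weil representation `𝓢.Omega = ⊗'_v ω_v` of a
restricted family of LOCAL SPLITTINGS `𝓢 : FinLocalSplittings` of the big unitary group `U(reindex e e (J_V ⊗ₖ J_W))`
(`GelbartRogawski1991/FiniteAdelicSplittingAssembly`): every operator-side hypothesis of `finCoeff_isPureTensor` is
then a tree theorem —
* `hω` is `FinLocalSplittings.Omega_piProdSB` (`Ω(g)(⊗Φ_v) = ⊗ ω_v(g_v)Φ_v`),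
* `hE` ∕ `hEint` are the place-component lemmas of `finPairEmb` (`UnitaryGroupDualPairReindexPlaces`:
  `evalPlace_finPairEmb_eq_symm_mulSingle`, `evalPlace_finPairEmb_symm_mulSingle_mem_localInt`),
and what remains displayed is: `hωΩ : ωfin u = Ω(1 ⊗ u)` (at the cell's pin and the `χ`-line this is ★
`WeilCoinv.finPairRepW_chiSplittingLine_apply`, for `ωfin := R_e ∘ finPairRepW ∘ R_e⁻¹`), the finite exceptional set `T`
(`hρT`: `1_{𝒪_vⁿ}` is `U(𝒪_v)`-fixed off `T` — `𝓢.unitVec_mem_fixedPoints` gives one), and the character `w` trivial on the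
box subgroup of level `T` (`exists_forall_boxSubgroup_eq_one` below: automatic for a continuous unitary `ψ : U(J_W)(𝔸_f) →* ℂˣ`).

Main results (namespace `Summit.HodgeConjecture.HodgeConjecture.Cruxes.H413.ThetaNonvanishing`):
* `exists_forall_boxSubgroup_eq_one` — a continuous unitary `ψ : U(J)(𝔸_{F,f}) →* ℂˣ` is trivial on
  `∏_{v∉T} U(J)(𝒪_v) × ∏_{v∈T} {1}` for some finite `T` (★ PerL34 `exists_boxSubgroup_le_ker`);
* `evalPlace_finPairEmb_one_eq_localCenter` — for a LINE `W` (`M = 1`, `J_W = J₁`, `(J₁)₀₀ ≠ 0`) the `v`-component of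
  `1 ⊗ u` is the LOCAL CENTRE element `localCenter v u_v = u_v · 1_n` of the big group (★ `finPairEmb_one_finAdelicCenter`,
  `finAdelicEquiv_finAdelicCenter`, `finAdelicCenter_finAdelicCenterInv`);
* **`finCoeff_isPureTensor_of_Omega_line`** — the line case with the local factor read THROUGH THE CENTRE,
  `fl_v(g) = (ν_v(𝒪_vⁿ)⁻¹ • ⟨ω_v(g · 1_n) Φ_v, Ψ_v⟩_{ν_v}) · w(e⁻¹ ι_v g)` — the currency of the cell's (F4) local bricks
  (`Li1992/RallisLocalFactor*`: `⟨ω_v(localCenter v z) Φ, Φ⟩ · conj χ_v(z)`);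
* `continuous_finCoeff_of_Omega` — the integrand `b ↦ ⟨ωfin(b)Θ, Ξ⟩_μ · w(b)` is continuous (`b ↦ Ω(1 ⊗ b)Θ` is locally
  constant: `FinLocalSplittings.isLocallyConstant_Omega_apply`), hence a.e. strongly measurable for every Borel measure —
  the `AEStronglyMeasurable f μ_f` input of ★ `exists_integral_finAdelic_eq_tprod`;
* **`finCoeff_isPureTensor_of_Omega`** — for `ωfin u = 𝓢.Omega (finPairEmb (1, u))`:
  `(∫ (ωfin(b)(⊗Φ_v)) conj(⊗Ψ_v) dμ) · w(b)` at `b = e⁻¹ glue_S(x, k)` equals `∏_{v∈S} fl_v(x_v)` (`S ⊇ T`), with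
  `fl_v(g) = (ν_v(𝒪_vⁿ)⁻¹ • ∫ (ω_v((1 ⊗ ι_v g)_v) Φ_v) conj(Ψ_v) dν_v) · w(e⁻¹ ι_v g)` (Haar constant absorbed at `i₀ ∈ T`) —
  the PURE-TENSOR binder of ★ `exists_integral_finAdelic_eq_tprod` for the S4b integrand, [Li1992, (27)] at the finite places.

[cite: Li1992, Thm 2.1 (27) p. 184] [cite: GelbartRogawski1991, §3.1 Prop. 3.1.1 p. 455] [cite: Weil1964, Chap. III n° 37–38 pp. 188–190]
-/

set_option autoImplicit false
set_option linter.dupNamespace false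

noncomputable section

open scoped RestrictedProduct ENNReal NNReal ComplexConjugate Matrix Kronecker
open MeasureTheory NumberField IsDedekindDomain Filter Function Set Topology
open Literature.NumberTheory.Automorphic Literature.NumberTheory.Automorphic.UnitaryGroup
open Literature.NumberTheory.GelbartRogawski1991.UnitaryDualPair.LocalSplitting
open HodgeCM.PerL34 HodgeCM.PerL34.RestrictedMeasure HodgeCM.PerL34.PureTensor HodgeCM.PerL34.NoSmallSubgroups

namespace Summit.HodgeConjecture.HodgeConjecture.Cruxes.H413.ThetaNonvanishing

/-! ## §1 Continuous unitary characters of `U(J)(𝔸_{F,f})` are trivial on a box subgroup -/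

section Char

variable (F E : Type) [Field F] [NumberField F] [Field E] [NumberField E] [Algebra F E]
  (c : E ≃ₐ[F] E) (M : ℕ) (JW : Matrix (Fin M) (Fin M) E)

/-- **a continuous unitary character `ψ : U(J)(𝔸_{F,f}) →* ℂˣ` is trivial on `∏_{v ∉ T} U(J)(𝒪_v) × ∏_{v ∈ T} {1}` for some
finite `T`** (the circle has no small subgroups; neighbourhoods of `1` in the restricted product contain box subgroups).
[cite: Li1992, Thm 2.1 (27) p. 184] -/
theorem exists_forall_boxSubgroup_eq_one (ψ : finAdelic F E c M JW →* ℂˣ)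
    (hψc : Continuous fun b => ((ψ b : ℂˣ) : ℂ)) (hψu : ∀ b, ‖((ψ b : ℂˣ) : ℂ)‖ = 1) :
    ∃ T : Finset (HeightOneSpectrum (𝓞 F)),
      ∀ k ∈ RestrictedProduct.boxSubgroup (fun v => localInt E c M JW v) T, ψ ((finAdelicEquiv F E c M JW).symm k) = 1 := by
  -- `ψ ∘ e⁻¹` as a continuous `Circle`-valued character of the restricted product
  let χ : (Πʳ v : HeightOneSpectrum (𝓞 F), [localPi E c M JW v, localInt E c M JW v]) →* Circle :=
    { toFun := fun k => ⟨((ψ ((finAdelicEquiv F E c M JW).symm k) : ℂˣ) : ℂ),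
        mem_sphere_zero_iff_norm.2 (hψu _)⟩
      map_one' := Subtype.ext (by simp only [map_one, Units.val_one, Circle.coe_one])
      map_mul' := fun a b => Subtype.ext (by simp only [map_mul, Units.val_mul, Circle.coe_mul]) }
  have hχ : Continuous χ :=
    (hψc.comp (finAdelicEquiv F E c M JW).symm.continuous).subtype_mk _
  obtain ⟨T, hT⟩ := exists_boxSubgroup_le_ker (fun v => localInt E c M JW v) (fun v => isOpen_localInt E c M JW v) χ hχ
  refine ⟨T, fun k hk => ?_⟩
  have h1 : χ k = 1 := (MonoidHom.mem_ker).1 (hT hk)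
  have h2 : ((ψ ((finAdelicEquiv F E c M JW).symm k) : ℂˣ) : ℂ) = 1 := by
    simpa only [χ, MonoidHom.coe_mk, OneHom.coe_mk, Circle.coe_one] using congrArg (fun z : Circle => (z : ℂ)) h1
  exact Units.ext h2

end Char

/-! ## §2 The pure-tensor identity for `ωfin u = Ω(1 ⊗ u)` -/

section Omega

variable (F E : Type) [Field F] [NumberField F] [Field E] [NumberField E] [Algebra F E]
  [Algebra.IsQuadraticExtension F E] (c : E ≃ₐ[F] E) (N M : ℕ) {n : ℕ} (e : Fin N × Fin M ≃ Fin n)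
  (JV : Matrix (Fin N) (Fin N) E) (JW : Matrix (Fin M) (Fin M) E)
  {δ : E} (hcδ : c δ = -δ) (hδ : δ ≠ 0) {d : F} (hd : δ * δ = algebraMap F E d)
  (Tb : Matrix (Fin n) (Fin n) F) (hTb : Tb.IsSymm) (hJb : Matrix.reindex e e (JV ⊗ₖ JW) = Tb.map (algebraMap F E))
  (𝓢 : FinLocalSplittings F E c n hcδ hδ hd Tb hTb hJb)
  [DecidableEq (HeightOneSpectrum (𝓞 F))]
  (ωfin : finAdelic F E c M JW → ↥(SchwartzBruhat (Fin n → FiniteAdeleRing (𝓞 F) F)) →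
    ↥(SchwartzBruhat (Fin n → FiniteAdeleRing (𝓞 F) F)))
  (hωΩ : ∀ u f, ωfin u f = 𝓢.Omega (finPairEmb F E c N M e JV JW (1, u)) f)
  (w : finAdelic F E c M JW →* ℂ) (T : Finset (HeightOneSpectrum (𝓞 F)))
  (hw : ∀ k ∈ RestrictedProduct.boxSubgroup (fun v => localInt E c M JW v) T,
    w ((finAdelicEquiv F E c M JW).symm k) = 1)
  (hρT : ∀ v ∉ T, unitVec F (Fin n) v ∈
    (𝓢.omegaLoc v).fixedPoints (localInt E c n (Matrix.reindex e e (JV ⊗ₖ JW)) v))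
  [MeasurableSpace (FiniteAdeleRing (𝓞 F) F)] [BorelSpace (FiniteAdeleRing (𝓞 F) F)]
  [∀ v : HeightOneSpectrum (𝓞 F), MeasurableSpace (v.adicCompletion F)]
  [∀ v : HeightOneSpectrum (𝓞 F), BorelSpace (v.adicCompletion F)]
  (μ : Measure (Fin n → FiniteAdeleRing (𝓞 F) F)) [μ.IsAddHaarMeasure]
  (ν : ∀ v : HeightOneSpectrum (𝓞 F), Measure (Fin n → v.adicCompletion F)) [∀ v, (ν v).IsAddHaarMeasure]
  (Φ Ψ : LocalSBFamily F (Fin n)) (hΦ : ∀ v ∉ T, Φ v = unitVec F (Fin n) v) (hΨ : ∀ v ∉ T, Ψ v = unitVec F (Fin n) v)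

include hωΩ hw hρT hΦ hΨ in
/-- **(F2) for `ωfin u = Ω(1 ⊗ u)`: the finite Fourier-coefficient integrand of two pure tensors is a pure tensor**, in the
shape of the binder of ★ `exists_integral_finAdelic_eq_tprod` (Haar constant `μ(𝒪̂ⁿ)` absorbed at `i₀ ∈ T`); the local
factor at `v` is `(ν_v(𝒪_vⁿ)⁻¹ • ⟨ω_v((1 ⊗ ι_v g)_v) Φ_v, Ψ_v⟩_{ν_v}) · w(e⁻¹ ι_v g)`.
[cite: Li1992, Thm 2.1 (27) p. 184] [cite: Weil1964, Chap. III n° 37–38 pp. 188–190] -/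
theorem finCoeff_isPureTensor_of_Omega {i₀ : HeightOneSpectrum (𝓞 F)} (hi₀ : i₀ ∈ T)
    (S : Finset (HeightOneSpectrum (𝓞 F))) (hTS : T ⊆ S)
    (x : ((v : ↥S) → localPi E c M JW v) × ((v : {v // v ∉ S}) → (localInt E c M JW v : Set (localPi E c M JW v)))) :
    (∫ y, ((ωfin ((finAdelicEquiv F E c M JW).symm
          (glue (fun v => (localInt E c M JW v : Set (localPi E c M JW v))) S x))
          (piProdSB F (Fin n) Φ) : ↥(SchwartzBruhat (Fin n → FiniteAdeleRing (𝓞 F) F))) :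
          (Fin n → FiniteAdeleRing (𝓞 F) F) → ℂ) y *
        conj (((piProdSB F (Fin n) Ψ : ↥(SchwartzBruhat (Fin n → FiniteAdeleRing (𝓞 F) F))) :
          (Fin n → FiniteAdeleRing (𝓞 F) F) → ℂ) y) ∂μ) *
      w ((finAdelicEquiv F E c M JW).symm (glue (fun v => (localInt E c M JW v : Set (localPi E c M JW v))) S x)) =
    ∏ v : ↥S, Function.update
      (fun (v : HeightOneSpectrum (𝓞 F)) (g : localPi E c M JW v) =>
        (((ν v (integralBox F (Fin n) v)).toReal⁻¹ •
          ∫ z, ((𝓢.omegaLoc v (evalPlace F E c n (Matrix.reindex e e (JV ⊗ₖ JW)) v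
              (finPairEmb F E c N M e JV JW (1, (finAdelicEquiv F E c M JW).symm
                (RestrictedProduct.mulSingle (fun v => localInt E c M JW v) v g)))) (Φ v) :
              ↥(SchwartzBruhat (Fin n → v.adicCompletion F))) : (Fin n → v.adicCompletion F) → ℂ) z *
            conj (((Ψ v : ↥(SchwartzBruhat (Fin n → v.adicCompletion F))) :
              (Fin n → v.adicCompletion F) → ℂ) z) ∂ν v) *
          w ((finAdelicEquiv F E c M JW).symm (RestrictedProduct.mulSingle (fun v => localInt E c M JW v) v g))))
      i₀ (fun g => (μ (offBox (ι := Fin n) ∅)).toReal •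
        ((((ν i₀ (integralBox F (Fin n) i₀)).toReal⁻¹ •
          ∫ z, ((𝓢.omegaLoc i₀ (evalPlace F E c n (Matrix.reindex e e (JV ⊗ₖ JW)) i₀
              (finPairEmb F E c N M e JV JW (1, (finAdelicEquiv F E c M JW).symm
                (RestrictedProduct.mulSingle (fun v => localInt E c M JW v) i₀ g)))) (Φ i₀) :
              ↥(SchwartzBruhat (Fin n → i₀.adicCompletion F))) : (Fin n → i₀.adicCompletion F) → ℂ) z *
            conj (((Ψ i₀ : ↥(SchwartzBruhat (Fin n → i₀.adicCompletion F))) :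
              (Fin n → i₀.adicCompletion F) → ℂ) z) ∂ν i₀) *
          w ((finAdelicEquiv F E c M JW).symm (RestrictedProduct.mulSingle (fun v => localInt E c M JW v) i₀ g)))))
      v.1 (x.1 v) :=
  finCoeff_isPureTensor F E c M JW (fun v => localInt E c n (Matrix.reindex e e (JV ⊗ₖ JW)) v) 𝓢.omegaLoc
    𝓢.unitVec_mem_fixedPoints
    (fun u => finAdelicEquiv F E c n (Matrix.reindex e e (JV ⊗ₖ JW)) (finPairEmb F E c N M e JV JW (1, u)))
    (fun v g => evalPlace F E c n (Matrix.reindex e e (JV ⊗ₖ JW)) v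
      (finPairEmb F E c N M e JV JW (1, (finAdelicEquiv F E c M JW).symm
        (RestrictedProduct.mulSingle (fun v => localInt E c M JW v) v g))))
    (fun u v => evalPlace_finPairEmb_eq_symm_mulSingle F E c N M e JV JW 1 u v)
    ωfin (fun u Φ' => by rw [hωΩ, FinLocalSplittings.Omega_piProdSB])
    w T hw
    (fun v _ g hg => evalPlace_finPairEmb_symm_mulSingle_mem_localInt F E c N M e JV JW 1 v
      (by rw [map_one]; exact one_mem _) g hg)
    hρT μ ν Φ Ψ hΦ hΨ hi₀ S hTS x

end Omega

/-! ## §3 The line case `M = 1`: local factors through the centre `u_v ↦ u_v · 1_n` -/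

section Line

variable (F E : Type) [Field F] [NumberField F] [Field E] [NumberField E] [Algebra F E]
  (c : E ≃ₐ[F] E) (N : ℕ) {n : ℕ} (e : Fin N × Fin 1 ≃ Fin n)
  (JV : Matrix (Fin N) (Fin N) E) (J₁ : Matrix (Fin 1) (Fin 1) E) (hJ₁ : J₁ 0 0 ≠ 0)

/-- **for a line `W`, the `v`-component of `1 ⊗ u` is the local centre element `u_v · 1_n`**:
`evalPlace v (finPairEmb (1, u)) = localCenter v (evalPlace v u)` (`u = (det u)·1_1`, ★ `finPairEmb_one_finAdelicCenter`,
★ `finAdelicEquiv_finAdelicCenter`). [cite: Li1992, Thm 2.1 (27) p. 184] [cite: GelbartRogawski1991, §3.2 p. 457] -/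
theorem evalPlace_finPairEmb_one_eq_localCenter (u : finAdelic F E c 1 J₁) (v : HeightOneSpectrum (𝓞 F)) :
    evalPlace F E c n (Matrix.reindex e e (JV ⊗ₖ J₁)) v (finPairEmb F E c N 1 e JV J₁ (1, u)) =
      localCenter E c n (Matrix.reindex e e (JV ⊗ₖ J₁)) J₁ hJ₁ v (evalPlace F E c 1 J₁ v u) := by
  conv_lhs => rw [← finAdelicCenter_finAdelicCenterInv F E c J₁ hJ₁ u]
  rw [finPairEmb_one_finAdelicCenter]
  change finAdelicEquiv F E c n (Matrix.reindex e e (JV ⊗ₖ J₁))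
    (finAdelicCenter F E c n (Matrix.reindex e e (JV ⊗ₖ J₁)) (finAdelicCenterInv F E c J₁ hJ₁ u)) v = _
  rw [finAdelicEquiv_finAdelicCenter F E c n (Matrix.reindex e e (JV ⊗ₖ J₁)) J₁ hJ₁]
  congr 1
  change evalPlace F E c 1 J₁ v (finAdelicCenter F E c 1 J₁ (finAdelicCenterInv F E c J₁ hJ₁ u)) = _
  rw [finAdelicCenter_finAdelicCenterInv]

variable [Algebra.IsQuadraticExtension F E] {δ : E} (hcδ : c δ = -δ) (hδ : δ ≠ 0) {d : F} (hd : δ * δ = algebraMap F E d)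
  (Tb : Matrix (Fin n) (Fin n) F) (hTb : Tb.IsSymm) (hJb : Matrix.reindex e e (JV ⊗ₖ J₁) = Tb.map (algebraMap F E))
  (𝓢 : FinLocalSplittings F E c n hcδ hδ hd Tb hTb hJb)
  [DecidableEq (HeightOneSpectrum (𝓞 F))]
  (ωfin : finAdelic F E c 1 J₁ → ↥(SchwartzBruhat (Fin n → FiniteAdeleRing (𝓞 F) F)) →
    ↥(SchwartzBruhat (Fin n → FiniteAdeleRing (𝓞 F) F)))
  (hωΩ : ∀ u f, ωfin u f = 𝓢.Omega (finPairEmb F E c N 1 e JV J₁ (1, u)) f)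
  (w : finAdelic F E c 1 J₁ →* ℂ) (T : Finset (HeightOneSpectrum (𝓞 F)))
  (hw : ∀ k ∈ RestrictedProduct.boxSubgroup (fun v => localInt E c 1 J₁ v) T, w ((finAdelicEquiv F E c 1 J₁).symm k) = 1)
  (hρT : ∀ v ∉ T, unitVec F (Fin n) v ∈
    (𝓢.omegaLoc v).fixedPoints (localInt E c n (Matrix.reindex e e (JV ⊗ₖ J₁)) v))
  [MeasurableSpace (FiniteAdeleRing (𝓞 F) F)] [BorelSpace (FiniteAdeleRing (𝓞 F) F)]
  [∀ v : HeightOneSpectrum (𝓞 F), MeasurableSpace (v.adicCompletion F)]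
  [∀ v : HeightOneSpectrum (𝓞 F), BorelSpace (v.adicCompletion F)]
  (μ : Measure (Fin n → FiniteAdeleRing (𝓞 F) F)) [μ.IsAddHaarMeasure]
  (ν : ∀ v : HeightOneSpectrum (𝓞 F), Measure (Fin n → v.adicCompletion F)) [∀ v, (ν v).IsAddHaarMeasure]
  (Φ Ψ : LocalSBFamily F (Fin n)) (hΦ : ∀ v ∉ T, Φ v = unitVec F (Fin n) v) (hΨ : ∀ v ∉ T, Ψ v = unitVec F (Fin n) v)

include hωΩ hw hρT hΦ hΨ in
/-- **(F2), line case, local factors through the centre.**  For a line `W = (J₁)`, `ωfin u = Ω(1 ⊗ u)` with `Ω = ⊗'_v ω_v`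
(`𝓢 : FinLocalSplittings` of `U(reindex e e (J_V ⊗ₖ J₁))`), pure tensors `⊗Φ_v`, `⊗Ψ_v` unramified off `T` and a multiplicative
`w` trivial on the box subgroup of level `T`: on every level `S ⊇ T`,
`(∫ (ωfin(b)(⊗Φ_v)) conj(⊗Ψ_v) dμ) · w(b) = ∏_{v ∈ S} fl'_v(x_v)` at `b = e⁻¹ glue_S(x, k)`, where
`fl_v(g) = (ν_v(𝒪_vⁿ)⁻¹ • ∫ (ω_v(g · 1_n) Φ_v) conj(Ψ_v) dν_v) · w(e⁻¹ ι_v g)` and `fl' = update fl i₀ (μ(𝒪̂ⁿ) • fl i₀)` —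
the binder of ★ `exists_integral_finAdelic_eq_tprod`, with the local integrand of the (F4) bricks
(`⟨ω_v(localCenter v z) Φ_v, Ψ_v⟩ · w_v(z)`). [cite: Li1992, Thm 2.1 (27) p. 184] [cite: Weil1964, Chap. III n° 37–38 pp. 188–190] -/
theorem finCoeff_isPureTensor_of_Omega_line {i₀ : HeightOneSpectrum (𝓞 F)} (hi₀ : i₀ ∈ T)
    (S : Finset (HeightOneSpectrum (𝓞 F))) (hTS : T ⊆ S)
    (x : ((v : ↥S) → localPi E c 1 J₁ v) × ((v : {v // v ∉ S}) → (localInt E c 1 J₁ v : Set (localPi E c 1 J₁ v)))) :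
    (∫ y, ((ωfin ((finAdelicEquiv F E c 1 J₁).symm
          (glue (fun v => (localInt E c 1 J₁ v : Set (localPi E c 1 J₁ v))) S x))
          (piProdSB F (Fin n) Φ) : ↥(SchwartzBruhat (Fin n → FiniteAdeleRing (𝓞 F) F))) :
          (Fin n → FiniteAdeleRing (𝓞 F) F) → ℂ) y *
        conj (((piProdSB F (Fin n) Ψ : ↥(SchwartzBruhat (Fin n → FiniteAdeleRing (𝓞 F) F))) :
          (Fin n → FiniteAdeleRing (𝓞 F) F) → ℂ) y) ∂μ) *
      w ((finAdelicEquiv F E c 1 J₁).symm (glue (fun v => (localInt E c 1 J₁ v : Set (localPi E c 1 J₁ v))) S x)) =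
    ∏ v : ↥S, Function.update
      (fun (v : HeightOneSpectrum (𝓞 F)) (g : localPi E c 1 J₁ v) =>
        (((ν v (integralBox F (Fin n) v)).toReal⁻¹ •
          ∫ z, ((𝓢.omegaLoc v (localCenter E c n (Matrix.reindex e e (JV ⊗ₖ J₁)) J₁ hJ₁ v g) (Φ v) :
              ↥(SchwartzBruhat (Fin n → v.adicCompletion F))) : (Fin n → v.adicCompletion F) → ℂ) z *
            conj (((Ψ v : ↥(SchwartzBruhat (Fin n → v.adicCompletion F))) :
              (Fin n → v.adicCompletion F) → ℂ) z) ∂ν v) *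
          w ((finAdelicEquiv F E c 1 J₁).symm (RestrictedProduct.mulSingle (fun v => localInt E c 1 J₁ v) v g))))
      i₀ (fun g => (μ (offBox (ι := Fin n) ∅)).toReal •
        ((((ν i₀ (integralBox F (Fin n) i₀)).toReal⁻¹ •
          ∫ z, ((𝓢.omegaLoc i₀ (localCenter E c n (Matrix.reindex e e (JV ⊗ₖ J₁)) J₁ hJ₁ i₀ g) (Φ i₀) :
              ↥(SchwartzBruhat (Fin n → i₀.adicCompletion F))) : (Fin n → i₀.adicCompletion F) → ℂ) z *
            conj (((Ψ i₀ : ↥(SchwartzBruhat (Fin n → i₀.adicCompletion F))) :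
              (Fin n → i₀.adicCompletion F) → ℂ) z) ∂ν i₀) *
          w ((finAdelicEquiv F E c 1 J₁).symm (RestrictedProduct.mulSingle (fun v => localInt E c 1 J₁ v) i₀ g)))))
      v.1 (x.1 v) :=
  finCoeff_isPureTensor F E c 1 J₁ (fun v => localInt E c n (Matrix.reindex e e (JV ⊗ₖ J₁)) v) 𝓢.omegaLoc
    𝓢.unitVec_mem_fixedPoints
    (fun u => finAdelicEquiv F E c n (Matrix.reindex e e (JV ⊗ₖ J₁)) (finPairEmb F E c N 1 e JV J₁ (1, u)))
    (fun v g => localCenter E c n (Matrix.reindex e e (JV ⊗ₖ J₁)) J₁ hJ₁ v g)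
    (fun u v => evalPlace_finPairEmb_one_eq_localCenter F E c N e JV J₁ hJ₁ u v)
    ωfin (fun u Φ' => by rw [hωΩ, FinLocalSplittings.Omega_piProdSB])
    w T hw
    (fun v _ k hk => localCenter_mapsTo_localInt E c n (Matrix.reindex e e (JV ⊗ₖ J₁)) J₁ hJ₁ v hk)
    hρT μ ν Φ Ψ hΦ hΨ hi₀ S hTS x

end Line

/-! ## §4 The integrand is continuous (hence a.e. strongly measurable) -/

section Continuity

variable (F E : Type) [Field F] [NumberField F] [Field E] [NumberField E] [Algebra F E]
  [Algebra.IsQuadraticExtension F E] (c : E ≃ₐ[F] E) (N M : ℕ) {n : ℕ} (e : Fin N × Fin M ≃ Fin n)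
  (JV : Matrix (Fin N) (Fin N) E) (JW : Matrix (Fin M) (Fin M) E)
  {δ : E} (hcδ : c δ = -δ) (hδ : δ ≠ 0) {d : F} (hd : δ * δ = algebraMap F E d)
  (Tb : Matrix (Fin n) (Fin n) F) (hTb : Tb.IsSymm) (hJb : Matrix.reindex e e (JV ⊗ₖ JW) = Tb.map (algebraMap F E))
  (𝓢 : FinLocalSplittings F E c n hcδ hδ hd Tb hTb hJb)
  (ωfin : finAdelic F E c M JW → ↥(SchwartzBruhat (Fin n → FiniteAdeleRing (𝓞 F) F)) →
    ↥(SchwartzBruhat (Fin n → FiniteAdeleRing (𝓞 F) F)))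
  (hωΩ : ∀ u f, ωfin u f = 𝓢.Omega (finPairEmb F E c N M e JV JW (1, u)) f)

include hωΩ in
/-- `b ↦ ωfin(b) Θ = Ω(1 ⊗ b) Θ` is locally constant on `U(J_W)(𝔸_{F,f})` (smoothness of `Ω = ⊗' ω_v`, continuity of `b ↦ 1 ⊗ b`).
[cite: Li1992, Thm 2.1 (27) p. 184] [cite: GelbartRogawski1991, §3.2 p. 457] -/
theorem isLocallyConstant_apply_of_Omega (Θ : ↥(SchwartzBruhat (Fin n → FiniteAdeleRing (𝓞 F) F))) :
    IsLocallyConstant fun b : finAdelic F E c M JW => ωfin b Θ := by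
  have hpe : Continuous (finPairEmb F E c N M e JV JW) :=
    Continuous.subtype_mk ((continuous_reindexGL e).comp (continuous_kroneckerGL.comp
      (continuous_subtype_val.prodMap continuous_subtype_val))) _
  have hcont : Continuous fun b : finAdelic F E c M JW => finPairEmb F E c N M e JV JW (1, b) :=
    hpe.comp (continuous_const.prodMk continuous_id)
  have h := (𝓢.isLocallyConstant_Omega_apply Θ).comp_continuous hcont
  have hfun : (fun b : finAdelic F E c M JW => ωfin b Θ) =
      (fun g => 𝓢.Omega g Θ) ∘ fun b : finAdelic F E c M JW => finPairEmb F E c N M e JV JW (1, b) :=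
    funext fun b => hωΩ b Θ
  rw [hfun]
  exact h

include hωΩ in
/-- **the finite Fourier-coefficient integrand `b ↦ (∫ (ωfin(b)Θ) conj(Ξ) dμ) · w(b)` is continuous** for a continuous
multiplicative `w` (the first factor is locally constant in `b`); in particular it is a.e. strongly measurable for every Borel
measure on `U(J_W)(𝔸_{F,f})`. [cite: Li1992, Thm 2.1 (27) p. 184] -/
theorem continuous_finCoeff_of_Omega (w : finAdelic F E c M JW →* ℂ) (hwc : Continuous w)
    [MeasurableSpace (FiniteAdeleRing (𝓞 F) F)] (μ : Measure (Fin n → FiniteAdeleRing (𝓞 F) F))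
    (Θ Ξ : ↥(SchwartzBruhat (Fin n → FiniteAdeleRing (𝓞 F) F))) :
    Continuous fun b : finAdelic F E c M JW =>
      (∫ y, ((ωfin b Θ : ↥(SchwartzBruhat (Fin n → FiniteAdeleRing (𝓞 F) F))) :
          (Fin n → FiniteAdeleRing (𝓞 F) F) → ℂ) y *
        conj (((Ξ : ↥(SchwartzBruhat (Fin n → FiniteAdeleRing (𝓞 F) F))) : (Fin n → FiniteAdeleRing (𝓞 F) F) → ℂ) y) ∂μ) *
      w b :=
  (((isLocallyConstant_apply_of_Omega F E c N M e JV JW hcδ hδ hd Tb hTb hJb 𝓢 ωfin hωΩ Θ).comp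
    (fun Θ' : ↥(SchwartzBruhat (Fin n → FiniteAdeleRing (𝓞 F) F)) =>
      ∫ y, ((Θ' : ↥(SchwartzBruhat (Fin n → FiniteAdeleRing (𝓞 F) F))) : (Fin n → FiniteAdeleRing (𝓞 F) F) → ℂ) y *
        conj (((Ξ : ↥(SchwartzBruhat (Fin n → FiniteAdeleRing (𝓞 F) F))) : (Fin n → FiniteAdeleRing (𝓞 F) F) → ℂ) y)
          ∂μ)).continuous).mul hwc

end Continuity

end Summit.HodgeConjecture.HodgeConjecture.Cruxes.H413.ThetaNonvanishing

end
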